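import Summits.AtomisticToContinuum.HydrodynamicLimit.Theses.RelayRaceLocality
import HarnessLib

/-!
# Crux `RestartPrinciple` (stmt-AtomisticToContinuum-12503), line `Sketch` — stub `stub_probTransfer`

Support file for the crux `Summit.AtomisticToContinuum.HydrodynamicLimit.Theses.RelayRaceLocality.RestartPrinciple`
(route `RelayRaceLocality`), line `Sketch`: the ELEMENTARY probabilistic transfer stub of the
restart induction. Convergence in probability to a constant `c` transfers from statistics `B_N`
under laws `ν_N` to statistics `A_N` under laws `μ_N` as soon as every bounded `1`-Lipschitz
statistic of the two agrees asymptotically, `E_{μ_N} F(A_N) - E_{ν_N} F(B_N) → 0`. Pure measure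
theory (Markov's inequality); nothing about hard spheres.

Proof: with the bounded `1`-Lipschitz test function `G x = min 1 ‖x - c‖` and `m = min 1 δ > 0`,
`μ_N {δ < ‖A_N - c‖} ≤ μ_N {m ≤ G ∘ A_N} ≤ m⁻¹ ∫ G ∘ A_N dμ_N` (`mul_meas_ge_le_integral_of_nonneg`),
`∫ G ∘ A_N dμ_N = (∫ G ∘ A_N dμ_N - ∫ G ∘ B_N dν_N) + ∫ G ∘ B_N dν_N`, and, for every `ε > 0`,
`∫ G ∘ B_N dν_N ≤ ε + ν_N {ε < ‖B_N - c‖}` (`G ≤ 1` on the event, `G ≤ ‖· - c‖ ≤ ε` off it). All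
three terms are eventually `< ε`, whence `μ_N {δ < ‖A_N - c‖} < 3ε / m` eventually.
-/

noncomputable section

open Literature.MathematicalPhysics.KineticTheory Literature.Analysis.FluidPDE
open Literature.Analysis.FunctionSpaces MeasureTheory Filter Set
open Summit.AtomisticToContinuum.HydrodynamicLimit.Theses.RelayRaceLocality

namespace Summit.AtomisticToContinuum.HydrodynamicLimit.Theorems.RestartPrinciple

/-- A measurable real function with values in `[0, 1]` is integrable against a finite measure
(`Integrable.of_mem_Icc`). [folklore] -/
private theorem integrable_of_unit_interval {Ω : Type*} [MeasurableSpace Ω] {P : Measure Ω}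
    [IsFiniteMeasure P] {f : Ω → ℝ} (hf : Measurable f) (h0 : ∀ z, 0 ≤ f z) (h1 : ∀ z, f z ≤ 1) :
    Integrable f P :=
  Integrable.of_mem_Icc 0 1 hf.aemeasurable (Eventually.of_forall fun z => ⟨h0 z, h1 z⟩)

/-- Truncation bound on a probability space: for measurable real `f, g` with `0 ≤ f ≤ 1` and
`f ≤ g` pointwise, and every `ε > 0`, `∫ f dP ≤ ε + P {ε < g}` (bound `f` by `1` on the event
`{ε < g}` and by `g ≤ ε` off it, i.e. `f ≤ ε + 𝟙_{ε < g}`, and integrate). [folklore] -/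
private theorem integral_le_add_measureReal {Ω : Type*} [MeasurableSpace Ω] {P : Measure Ω}
    [IsProbabilityMeasure P] {f g : Ω → ℝ} (hf : Measurable f) (hg : Measurable g)
    (h0 : ∀ z, 0 ≤ f z) (h1 : ∀ z, f z ≤ 1) (hfg : ∀ z, f z ≤ g z) {ε : ℝ} (hε : 0 < ε) :
    ∫ z, f z ∂P ≤ ε + P.real {z | ε < g z} := by
  have hS : MeasurableSet {z | ε < g z} := measurableSet_lt measurable_const hg
  have hind : Integrable ({z | ε < g z}.indicator fun _ => (1 : ℝ)) P :=
    (integrable_const (1 : ℝ)).indicator hS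
  have hptw : ∀ z, f z ≤ ε + {z | ε < g z}.indicator (fun _ => (1 : ℝ)) z := by
    intro z
    by_cases hz : z ∈ {z | ε < g z}
    · rw [indicator_of_mem hz]
      linarith [h1 z]
    · rw [indicator_of_notMem hz]
      have hgz : g z ≤ ε := not_lt.1 hz
      linarith [hfg z]
  calc ∫ z, f z ∂P ≤ ∫ z, (ε + {z | ε < g z}.indicator (fun _ => (1 : ℝ)) z) ∂P :=
        integral_mono (integrable_of_unit_interval hf h0 h1) ((integrable_const ε).fun_add hind) hptw
    _ = ε + P.real {z | ε < g z} := by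
        rw [integral_add (integrable_const ε) hind, integral_const, integral_indicator_const _ hS,
          probReal_univ, one_smul, smul_eq_mul, mul_one]

/-- **Transfer of convergence in probability along asymptotically equal bounded-Lipschitz
statistics.** Let `μ_N, ν_N` be probability measures, `A_N, B_N` measurable statistics with
values in a normed group `E`, and `c : E`. If `E_{μ_N} F(A_N) - E_{ν_N} F(B_N) → 0` for every
`1`-Lipschitz `F : E → ℝ` with `|F| ≤ 1`, and `B_N → c` in `ν_N`-probability, then `A_N → c` in
`μ_N`-probability. (Markov's inequality with the test function `min 1 ‖· - c‖`.) [folklore] -/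
theorem stub_probTransfer :
    ∀ (E : Type) [NormedAddCommGroup E] [MeasurableSpace E] [BorelSpace E]
      (μ ν : (N : ℕ) → Measure (Config (N + 1) (Fin 3) T3))
      (A B : (N : ℕ) → Config (N + 1) (Fin 3) T3 → E) (c : E),
      (∀ N, IsProbabilityMeasure (μ N)) → (∀ N, IsProbabilityMeasure (ν N)) →
      (∀ N, Measurable (A N)) → (∀ N, Measurable (B N)) →
      (∀ F : E → ℝ, LipschitzWith 1 F → (∀ p, |F p| ≤ 1) →
        Tendsto (fun N => (∫ z, F (A N z) ∂μ N) - ∫ z, F (B N z) ∂ν N) atTop (nhds 0)) →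
      (∀ δ : ℝ, 0 < δ → Tendsto (fun N => ν N {z | δ < ‖B N z - c‖}) atTop (nhds 0)) →
      ∀ δ : ℝ, 0 < δ → Tendsto (fun N => μ N {z | δ < ‖A N z - c‖}) atTop (nhds 0) := by
  intro E _ _ _ μ ν A B c hμ hν hA hB hF hBc δ hδ
  -- the bounded `1`-Lipschitz test function `G = min 1 ‖· - c‖`, separating `c` at level `min 1 δ`
  obtain ⟨G, hG_lip, hG0, hG1, hGδ, hGle⟩ : ∃ G : E → ℝ, LipschitzWith 1 G ∧ (∀ x, 0 ≤ G x) ∧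
      (∀ x, G x ≤ 1) ∧ (∀ x, δ < ‖x - c‖ → min 1 δ ≤ G x) ∧ ∀ x, G x ≤ ‖x - c‖ := by
    refine ⟨fun x => min 1 ‖x - c‖, ?_, fun x => le_min zero_le_one (norm_nonneg _),
      fun x => min_le_left _ _, fun x hx => min_le_min_left 1 hx.le, fun x => min_le_right _ _⟩
    have h := (LipschitzWith.dist_left c).const_min 1
    simp only [dist_eq_norm] at h
    exact h
  have hG_meas : Measurable G := hG_lip.continuous.measurable
  have hlim : Tendsto (fun N => (∫ z, G (A N z) ∂μ N) - ∫ z, G (B N z) ∂ν N) atTop (nhds 0) :=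
    hF G hG_lip fun p => abs_le.2 ⟨by linarith [hG0 p], hG1 p⟩
  have hm : 0 < min 1 δ := lt_min one_pos hδ
  -- Markov: `μ_N {δ < ‖A_N - c‖} ≤ μ_N {min 1 δ ≤ G ∘ A_N} ≤ (∫ G ∘ A_N dμ_N) / min 1 δ`
  have hmarkov : ∀ N, (μ N).real {z | δ < ‖A N z - c‖} ≤ (∫ z, G (A N z) ∂μ N) / min 1 δ := by
    intro N
    have hint : Integrable (fun z => G (A N z)) (μ N) :=
      integrable_of_unit_interval (hG_meas.comp (hA N)) (fun z => hG0 _) fun z => hG1 _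
    rw [le_div_iff₀ hm]
    calc (μ N).real {z | δ < ‖A N z - c‖} * min 1 δ
        ≤ (μ N).real {z | min 1 δ ≤ G (A N z)} * min 1 δ :=
          mul_le_mul_of_nonneg_right (measureReal_mono
            (fun z (hz : δ < ‖A N z - c‖) => hGδ (A N z) hz) (measure_ne_top _ _)) hm.le
      _ ≤ ∫ z, G (A N z) ∂μ N := by
          rw [mul_comm]
          exact mul_meas_ge_le_integral_of_nonneg (ae_of_all _ fun z => hG0 (A N z)) hint (min 1 δ)
  -- the tail probabilities of `B_N` in `ℝ`: `ν_N {ε < ‖B_N - c‖} → 0`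
  have hνlim : ∀ ε : ℝ, 0 < ε →
      Tendsto (fun N => (ν N).real {z | ε < ‖B N z - c‖}) atTop (nhds 0) := by
    intro ε hε
    have h := (ENNReal.tendsto_toReal ENNReal.zero_ne_top).comp (hBc ε hε)
    rw [ENNReal.toReal_zero] at h
    exact h
  -- conclusion in `ℝ`: eventually `μ_N {δ < ‖A_N - c‖} < 3 ε / min 1 δ = a`
  have hreal : Tendsto (fun N => (μ N).real {z | δ < ‖A N z - c‖}) atTop (nhds 0) := by
    refine tendsto_order.2 ⟨fun a ha => Eventually.of_forall fun N =>
      ha.trans_le measureReal_nonneg, fun a ha => ?_⟩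
    have ha' : 0 < a := ha
    have hε : 0 < a * min 1 δ / 3 := div_pos (mul_pos ha' hm) three_pos
    filter_upwards [hlim.eventually_lt_const hε, (hνlim _ hε).eventually_lt_const hε] with N hdN hνN
    have hsplit := integral_le_add_measureReal (P := ν N) (f := fun z => G (B N z))
      (g := fun z => ‖B N z - c‖) (hG_meas.comp (hB N)) ((hB N).sub_const c).norm
      (fun z => hG0 _) (fun z => hG1 _) (fun z => hGle _) hε
    refine (hmarkov N).trans_lt ?_
    rw [div_lt_iff₀ hm]
    linarith
  -- back to `ℝ≥0∞`
  have h := ENNReal.tendsto_ofReal hreal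
  rw [ENNReal.ofReal_zero] at h
  exact h.congr fun N => ofReal_measureReal (measure_ne_top _ _)

end Summit.AtomisticToContinuum.HydrodynamicLimit.Theorems.RestartPrinciple

end
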